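import Mathlib
import Summits.MatrixMultiplication.MatrixMultiplication.Theses.MatrixPointInterpolation
import Summits.MatrixMultiplication.MatrixMultiplication.Theorems.TightWindows.Negative.LooseMasqueradesCore
-- buildfix 2026-08-19: `TightWindows` (stmt-18939, dropped from the route) is re-created in this module:
import Summits.MatrixMultiplication.MatrixMultiplication.Theorems.MatrixPointInterpolationTightWindowsRefutation
import Literature.Algebra.PolynomialIdentities.CentralPolynomialsMatrix
import Literature.Algebra.PolynomialIdentities.GenericMatricesGrowth

/-!
# `MatrixPointInterpolation.TightWindows` (stmt-MatrixMultiplication-18939) — Negative lane: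
# every masquerade is loose, part 2: `LongMasquerade → ¬ TightWindows`

Port to the tree (crux disprover) of the crux-strategist's negation-lens file
`Cruxes/TightWindows/LooseMasquerades.lean` (planner-cstrat-stmt-MatrixMultiplication-18939-b1-0,
2026-08-17), with its three "INPUTS" now discharged from the vendored literature:

* INPUT 1 (`CentralRegularElement`) := `exists_twoLetter_centralRegular h₁ h₂` from the named facts
  `h₁ : razmyslov_exists_multilinear_centralPolynomial` (Formanek 1972 / Razmyslov 1973, KBKR 2015
  Thm 1.4.17) and `h₂ : amitsur_genericMatrices_isDomain` (Amitsur; KBKR 2015 Thm 1.8.14)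
  [`Literature.Algebra.PolynomialIdentities.CentralPolynomialsMatrix`];
* INPUTS 2–3 (`GenericGrowthUpper/Lower`) := `h₃.upper`, `h₃.lower` from the named fact
  `h₃ : GenericMatricesQuasiPolynomialGrowth` (Procesi 1967 + Belov, KBKR 2015 §11.2.5, Thm 11.3.6,
  Thm 11.3.13) [`Literature.Algebra.PolynomialIdentities.GenericMatricesGrowth`].

## The argument ("anti-Riemann–Roch"; all constants depend on `k` only)

At a pair `A ∈ M_n(ℂ)²` generating `M_n` in degree `d` and masquerading as `M_k` to degree `2d`, the
two-letter central regular element `z` of degree `≤ g = g(k)` evaluates to a scalar, so by part 1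
(`finrank_add_wordDim_le` at `j = d`) `n² ≤ d̃_d − d̃_{d−g} ≤ K₁ g d^{k²}` (`d̃ = genericWordDim k`):
generation is SLOW, `d ≳ n^{2/k²}`; hence the window dimension `d̃_{2d} ≥ K₂ (2d)^{k²+1} ≳ n^{2+2/k²}`
— **every masquerade is loose by the factor `n^{2/k²}`** (`masquerade_loose`).  Along the family
supplied by `LongMasquerade` this contradicts `TightWindows` at `ε = 1/k²`:
`not_tightWindows_of_longMasquerade`, i.e. the route's deciding theorem
`closes (hL : LongMasquerade) (hT : TightWindows) …` has jointly unsatisfiable hypotheses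
(`longMasquerade_and_tightWindows_false`) — modulo the three named facts.  With the refuter's
`WindowedKaplansky → TightWindows` (W.lean, evidence on the item) the crux is then EQUIVALENT to the
route's kill target `WindowedKaplansky`; that direction has a positive conclusion and is not restated
in this (negative) file.  Finally, WITHOUT any literature input: at every masquerade
`n² ≤ genericWordDim k d < genericWordDim k (2d)` (`sq_le_genericWordDim`, `genericWordDim_lt_double`),
so the `ε = 0` slice of the crux is refuted by `LongMasquerade` unconditionally
(`not_tightWindowsZero_of_longMasquerade`).
-/

namespace Summit.MatrixMultiplication.MatrixMultiplication.Theorems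

namespace TightWindowsLoose

open scoped BigOperators
open Matrix
open Literature.Algebra.PolynomialIdentities

/-! ## Local notation: two-letter polynomials, evaluation, degree filtration, identities

(`local notation`, so that this negative-lane file declares no new definitions; the vocabulary is
the vendored one of `Literature.Algebra.PolynomialIdentities`.) -/

set_option quotPrecheck false

/-- Words in the two letters `0, 1` (local notation). [folklore] -/
local notation "Wd" => FreeMonoid (Fin 2)
/-- Non-commutative polynomials `ℂ⟨x₀, x₁⟩` = the monoid algebra of the free monoid (local notation).
[folklore] -/
local notation "NCP" => MonoidAlgebra ℂ (FreeMonoid (Fin 2))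
/-- Evaluation at a pair of matrices: the vendored `matEval` (local notation). [folklore] -/
local notation "evM" => Literature.Algebra.PolynomialIdentities.matEval
/-- The degree filtration `Pd⟦D⟧`: polynomials supported on words of length `≤ D` (local notation).
[folklore] -/
local notation:max "Pd⟦" D "⟧" =>
  (MonoidAlgebra.supported ℂ ℂ (setOf fun w : FreeMonoid (Fin 2) => (FreeMonoid.toList w).length ≤ D) :
    Submodule ℂ (MonoidAlgebra ℂ (FreeMonoid (Fin 2))))
/-- Identities of `M_k(ℂ)`: the vendored `IsMatrixIdentity` (local notation). [folklore] -/
local notation "IsId" => Literature.Algebra.PolynomialIdentities.IsMatrixIdentity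
/-- `evF⟦k⟧`: evaluation as a linear map into functions on pairs of `k × k` matrices (local
notation). [folklore] -/
local notation:max "evF⟦" k "⟧" =>
  (LinearMap.pi fun B : (Fin 2 → Matrix (Fin k) (Fin k) ℂ) =>
    (Literature.Algebra.PolynomialIdentities.matEval B).toLinearMap :
    MonoidAlgebra ℂ (FreeMonoid (Fin 2)) →ₗ[ℂ] ((Fin 2 → Matrix (Fin k) (Fin k) ℂ) → Matrix (Fin k) (Fin k) ℂ))





/-! ## Word count: generation in degree `d` forces `n² ≤ (d+1)·2^d` -/

/-- Generation in degree `d` forces `n² ≤ (d+1)·2^d` (crude word count). [folklore] -/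
theorem sq_le_of_span {n d : ℕ} {A : Fin 2 → Matrix (Fin n) (Fin n) ℂ}
    (hspan : Submodule.span ℂ {M : Matrix (Fin n) (Fin n) ℂ |
      ∃ w : List (Fin 2), w.length ≤ d ∧ (w.map A).prod = M} = ⊤) :
    n * n ≤ (d + 1) * 2 ^ d := by
  classical
  let F : Fin (d + 1) × (Fin d → Fin 2) → Matrix (Fin n) (Fin n) ℂ :=
    fun p => (((List.ofFn p.2).take p.1).map A).prod
  have hsub : {M : Matrix (Fin n) (Fin n) ℂ | ∃ w : List (Fin 2), w.length ≤ d ∧ (w.map A).prod = M}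
      ⊆ ((Finset.univ.image F : Finset (Matrix (Fin n) (Fin n) ℂ)) : Set (Matrix (Fin n) (Fin n) ℂ)) := by
    rintro M ⟨w, hw, rfl⟩
    simp only [Finset.coe_image, Finset.coe_univ, Set.image_univ, Set.mem_range]
    refine ⟨(⟨w.length, by omega⟩, fun i => w[(i : ℕ)]?.getD 0), ?_⟩
    have hl : ((List.ofFn fun i : Fin d => w[(i : ℕ)]?.getD 0).take w.length) = w := by
      apply List.ext_getElem
      · simp; omega
      · intro k h1 h2
        simp [List.getElem?_eq_getElem h2]
    simp only [F, hl]
  have h1 : Module.finrank ℂ (Matrix (Fin n) (Fin n) ℂ) ≤ (Finset.univ.image F).card := by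
    have hle := finrank_span_finset_le_card (R := ℂ) (Finset.univ.image F)
    rw [Set.finrank] at hle
    rw [← finrank_top, ← hspan]
    exact (Submodule.finrank_mono (Submodule.span_mono hsub)).trans hle
  have h2 : (Finset.univ.image F).card ≤ (d + 1) * 2 ^ d :=
    Finset.card_image_le.trans (by simp)
  rw [Module.finrank_matrix, Fintype.card_fin, Module.finrank_self, mul_one] at h1
  exact h1.trans h2

/-- Generation in degree `d` with `n > (g+1)·2^g` forces `g ≤ d`. [folklore] -/
theorem le_deg_of_span {n d g : ℕ} {A : Fin 2 → Matrix (Fin n) (Fin n) ℂ}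
    (hspan : Submodule.span ℂ {M : Matrix (Fin n) (Fin n) ℂ |
      ∃ w : List (Fin 2), w.length ≤ d ∧ (w.map A).prod = M} = ⊤)
    (hn : (g + 1) * 2 ^ g < n) : g ≤ d := by
  by_contra h
  push Not at h
  have h1 := sq_le_of_span hspan
  have h2 : (d + 1) * 2 ^ d ≤ (g + 1) * 2 ^ g :=
    Nat.mul_le_mul (by omega) (Nat.pow_le_pow_right (by norm_num) h.le)
  have h3 : n ≤ n * n := Nat.le_mul_self n
  omega

/-! ## Looseness of masquerades -/

/-- **Every masquerade is loose.**  Under the three named facts, for every `k ≥ 2` there are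
constants such that every pair `A ∈ M_n(ℂ)²` generating `M_n` in degree `d` and masquerading as `M_k`
to degree `2d` (with `n` beyond an explicit threshold) has `n² ≤ K₁ g d^{k²}` — generation is SLOW,
forced by the central character — while the window dimension is `≥ K₂ (2d)^{k²+1}`.
[cite: KanelBelovKarasikRowen2015, Thm 1.4.17 + Thm 1.8.14 + Thm 11.3.6 + Thm 11.3.13 + §11.2.5 (consequence)] -/
theorem masquerade_loose (h₁ : razmyslov_exists_multilinear_centralPolynomial)
    (h₂ : amitsur_genericMatrices_isDomain) (h₃ : GenericMatricesQuasiPolynomialGrowth)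
    {k : ℕ} (hk : 2 ≤ k) :
    ∃ (K₁ K₂ : ℝ) (g : ℕ), 0 < K₁ ∧ 0 < K₂ ∧ 1 ≤ g ∧
      ∀ (n d : ℕ) (A : Fin 2 → Matrix (Fin n) (Fin n) ℂ), (g + 1) * 2 ^ g < n →
        Submodule.span ℂ {M : Matrix (Fin n) (Fin n) ℂ |
          ∃ w : List (Fin 2), w.length ≤ d ∧ (w.map A).prod = M} = ⊤ →
        (∀ (T : Finset (List (Fin 2))) (c : List (Fin 2) → ℂ), (∀ w ∈ T, w.length ≤ 2 * d) →
          (∀ B : Fin 2 → Matrix (Fin k) (Fin k) ℂ, (∑ w ∈ T, c w • (w.map B).prod) = 0) →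
          (∑ w ∈ T, c w • (w.map A).prod) = 0) →
        ((n : ℝ) ^ 2 ≤ K₁ * g * (d : ℝ) ^ (k ^ 2) ∧
          K₂ * (2 * (d : ℝ)) ^ (k ^ 2 + 1) ≤ genericWordDim k (2 * d) ∧ 1 ≤ d) := by
  obtain ⟨g, hg1, z, hz, hzc, hreg⟩ := exists_twoLetter_centralRegular h₁ h₂ k hk
  obtain ⟨K₁, hK₁, hK₁b⟩ := h₃.upper k hk
  obtain ⟨K₂, hK₂, hK₂b⟩ := h₃.lower k hk
  refine ⟨K₁, K₂, g, hK₁, hK₂, hg1, fun n d A hn hspan hwin => ?_⟩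
  have hgd : g ≤ d := le_deg_of_span hspan hn
  have hd1 : 1 ≤ d := le_trans hg1 hgd
  have hg2d : g + 1 ≤ 2 * d := by omega
  have key := finrank_add_wordDim_le hspan hwin (z := z) hz hg2d hzc hreg hgd (by omega : d ≤ 2 * d)
  have hV : Module.finrank ℂ ((Pd⟦d⟧).map (evM A).toLinearMap) = n ^ 2 := by
    rw [map_evM_Pd, hspan, finrank_top, Module.finrank_matrix, Fintype.card_fin, Module.finrank_self,
      mul_one, sq]
  rw [hV] at key
  refine ⟨?_, ?_, hd1⟩
  · have h1 := hK₁b d g hd1 hgd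
    have h2 : ((n ^ 2 : ℕ) : ℝ) + (genericWordDim k (d - g) : ℝ) ≤ (genericWordDim k d : ℝ) := by
      exact_mod_cast key
    push_cast at h2
    linarith
  · have := hK₂b (2 * d) (by omega)
    push_cast at this
    exact this

/-- The exponent bookkeeping: `n² ≤ K₁ g d^q` and `K₂ (2d)^{q+1} ≤ n^{2 + 1/q}` bound `n`. [folklore] -/
theorem bounded_of_loose {q : ℕ} (hq : 1 ≤ q) (K₁ g : ℝ) {K₂ : ℝ} (hK₂ : 0 < K₂) :
    ∃ M : ℝ, ∀ (n d : ℝ), M < n → 1 ≤ d → n ^ 2 ≤ K₁ * g * d ^ q →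
      K₂ * (2 * d) ^ (q + 1) ≤ n ^ ((2 : ℝ) + 1 / q) → False := by
  set C₁ : ℝ := (K₁ * g) ^ (q + 1) with hC₁
  set C₂ : ℝ := K₂ ^ q * (2 : ℝ) ^ ((q + 1) * q) with hC₂
  have hC₂pos : 0 < C₂ := by positivity
  refine ⟨max 1 (C₁ / C₂), fun n d hn hd hb hc => ?_⟩
  have hn1 : 1 < n := lt_of_le_of_lt (le_max_left _ _) hn
  have hn0 : 0 < n := by linarith
  have hd0 : 0 < d := by linarith
  have hqr : (q : ℝ) ≠ 0 := by exact_mod_cast (show q ≠ 0 by omega)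
  -- raise the window inequality to the q-th power
  have h1 : C₂ * d ^ ((q + 1) * q) ≤ n ^ (2 * q + 1) := by
    have h := pow_le_pow_left₀ (by positivity) hc q
    have e : (n ^ ((2 : ℝ) + 1 / q)) ^ q = n ^ (2 * q + 1) := by
      rw [← Real.rpow_natCast (n ^ ((2 : ℝ) + 1 / q)) q, ← Real.rpow_mul hn0.le]
      have : ((2 : ℝ) + 1 / q) * q = ((2 * q + 1 : ℕ) : ℝ) := by
        push_cast
        field_simp
      rw [this, Real.rpow_natCast]
    rw [e, mul_pow, ← pow_mul, mul_pow] at h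
    calc C₂ * d ^ ((q + 1) * q) = K₂ ^ q * ((2 : ℝ) ^ ((q + 1) * q) * d ^ ((q + 1) * q)) := by
          rw [hC₂]; ring
      _ ≤ n ^ (2 * q + 1) := h
  -- raise the generation inequality to the (q+1)-st power
  have h2 : n ^ (2 * q + 1) * n ≤ C₁ * d ^ ((q + 1) * q) := by
    have h := pow_le_pow_left₀ (by positivity) hb (q + 1)
    rw [← pow_mul, mul_pow, ← pow_mul] at h
    calc n ^ (2 * q + 1) * n = n ^ (2 * (q + 1)) := by ring
      _ ≤ (K₁ * g) ^ (q + 1) * d ^ (q * (q + 1)) := h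
      _ = C₁ * d ^ ((q + 1) * q) := by rw [hC₁, mul_comm (q + 1) q]
  have hX : 0 < d ^ ((q + 1) * q) := by positivity
  have h3 : C₂ * n * d ^ ((q + 1) * q) ≤ C₁ * d ^ ((q + 1) * q) := by
    calc C₂ * n * d ^ ((q + 1) * q) = C₂ * d ^ ((q + 1) * q) * n := by ring
      _ ≤ n ^ (2 * q + 1) * n := mul_le_mul_of_nonneg_right h1 hn0.le
      _ ≤ C₁ * d ^ ((q + 1) * q) := h2
  have h4 : C₂ * n ≤ C₁ := le_of_mul_le_mul_right h3 hX
  have h5 : n ≤ C₁ / C₂ := by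
    rw [le_div_iff₀ hC₂pos]; linarith
  have h6 : C₁ / C₂ < n := lt_of_le_of_lt (le_max_right _ _) hn
  linarith

open Summit.MatrixMultiplication.MatrixMultiplication.Theses.MatrixPointInterpolation
  (LongMasquerade TightWindows)

/-! ## The `ε = 0` slice needs no growth facts: `n² ≤ d̃_d < d̃_{2d}` at every masquerade -/

/-- At a pair `A` masquerading as `M_k` to degree `2d`, for `j ≤ 2d` the span `V_j` of the words of
length `≤ j` at `A` is a quotient of the word-function space: `dim V_j ≤ genericWordDim k j`
(evaluation at `A` factors through the word functions on `(M_k)²` inside the window). [folklore] -/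
theorem finrank_map_le_genericWordDim {n k d : ℕ} {A : Fin 2 → Matrix (Fin n) (Fin n) ℂ}
    (hwin : ∀ (T : Finset (List (Fin 2))) (c : List (Fin 2) → ℂ), (∀ w ∈ T, w.length ≤ 2 * d) →
      (∀ B : Fin 2 → Matrix (Fin k) (Fin k) ℂ, (∑ w ∈ T, c w • (w.map B).prod) = 0) →
      (∑ w ∈ T, c w • (w.map A).prod) = 0)
    {j : ℕ} (hj : j ≤ 2 * d) :
    Module.finrank ℂ ((Pd⟦j⟧).map (evM A).toLinearMap) ≤ genericWordDim k j := by
  haveI := finiteDimensional_Pd j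
  let fA : Pd⟦j⟧ →ₗ[ℂ] Matrix (Fin n) (Fin n) ℂ := (evM A).toLinearMap.domRestrict (Pd⟦j⟧)
  let fE : Pd⟦j⟧ →ₗ[ℂ] ((Fin 2 → Matrix (Fin k) (Fin k) ℂ) → Matrix (Fin k) (Fin k) ℂ) :=
    (evF⟦k⟧).domRestrict (Pd⟦j⟧)
  have hker : LinearMap.ker fE ≤ LinearMap.ker fA := by
    intro q hq
    rw [LinearMap.mem_ker] at hq ⊢
    exact window_poly hwin (Pd_mono hj q.2) (evF_eq_zero_iff.1 hq)
  have e1 := LinearMap.finrank_range_add_finrank_ker fA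
  have e2 := LinearMap.finrank_range_add_finrank_ker fE
  have e3 : Module.finrank ℂ (LinearMap.ker fE) ≤ Module.finrank ℂ (LinearMap.ker fA) :=
    Submodule.finrank_mono hker
  have hrA : Module.finrank ℂ (LinearMap.range fA) =
      Module.finrank ℂ ((Pd⟦j⟧).map (evM A).toLinearMap) := by rw [range_domRestrict_eq_map]
  have hrE : Module.finrank ℂ (LinearMap.range fE) = genericWordDim k j := by
    rw [range_domRestrict_eq_map, wordDim_eq]
  omega

/-- **The automatic lower bound** (the crux's parenthesis "n² ≤ that dimension is automatic"): a pair
generating `M_n` in degree `d` and masquerading as `M_k` to degree `2d` has `n² ≤ genericWordDim k d`.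
[folklore] -/
theorem sq_le_genericWordDim {n k d : ℕ} {A : Fin 2 → Matrix (Fin n) (Fin n) ℂ}
    (hspan : Submodule.span ℂ {M : Matrix (Fin n) (Fin n) ℂ |
      ∃ w : List (Fin 2), w.length ≤ d ∧ (w.map A).prod = M} = ⊤)
    (hwin : ∀ (T : Finset (List (Fin 2))) (c : List (Fin 2) → ℂ), (∀ w ∈ T, w.length ≤ 2 * d) →
      (∀ B : Fin 2 → Matrix (Fin k) (Fin k) ℂ, (∑ w ∈ T, c w • (w.map B).prod) = 0) →
      (∑ w ∈ T, c w • (w.map A).prod) = 0) :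
    n ^ 2 ≤ genericWordDim k d := by
  have h := finrank_map_le_genericWordDim hwin (j := d) (by omega)
  rwa [map_evM_Pd, hspan, finrank_top, Module.finrank_matrix, Fintype.card_fin, Module.finrank_self,
    mul_one, ← sq] at h

/-- **Strict growth across the window**: `genericWordDim k d < genericWordDim k (2d)` for `k, d ≥ 1`
— the power word `x₀^{2d}` is a word-function of length `2d` outside the span of those of length
`≤ d` (evaluate at scalar pairs `t • 1`: a polynomial identity `t^{2d} = Σ_{m ≤ d} a_m t^m` is
impossible). [folklore] -/
theorem genericWordDim_lt_double {k d : ℕ} (hk : 1 ≤ k) (hd : 1 ≤ d) :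
    genericWordDim k d < genericWordDim k (2 * d) := by
  haveI := Literature.Algebra.PolynomialIdentities.finite_span_wordMaps k (2 * d)
  unfold genericWordDim
  apply Submodule.finrank_lt_finrank_of_lt
  rw [lt_iff_le_and_ne]
  refine ⟨Submodule.span_mono fun f ⟨w, hw, hf⟩ => ⟨w, by omega, hf⟩, fun heq => ?_⟩
  -- the power word of length `2d` lies in the big span, hence (by `heq`) in the small one
  have hmem : (fun B : Fin 2 → Matrix (Fin k) (Fin k) ℂ => (B 0) ^ (2 * d)) ∈
      Submodule.span ℂ {f : (Fin 2 → Matrix (Fin k) (Fin k) ℂ) → Matrix (Fin k) (Fin k) ℂ |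
        ∃ w : List (Fin 2), w.length ≤ d ∧ f = fun B => (w.map B).prod} := by
    rw [heq]
    refine Submodule.subset_span ⟨List.replicate (2 * d) 0, by simp, ?_⟩
    funext B
    simp [List.map_replicate, List.prod_replicate]
  -- read it at scalar pairs: a polynomial identity of degree `2d` against degree `≤ d`
  obtain ⟨T, hT, c, hc⟩ : ∃ T : Finset ((Fin 2 → Matrix (Fin k) (Fin k) ℂ) → Matrix (Fin k) (Fin k) ℂ),
      (↑T ⊆ {f : (Fin 2 → Matrix (Fin k) (Fin k) ℂ) → Matrix (Fin k) (Fin k) ℂ |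
        ∃ w : List (Fin 2), w.length ≤ d ∧ f = fun B => (w.map B).prod}) ∧
      ∃ c : ((Fin 2 → Matrix (Fin k) (Fin k) ℂ) → Matrix (Fin k) (Fin k) ℂ) → ℂ,
        ∑ f ∈ T, c f • f = fun B => (B 0) ^ (2 * d) := by
    rcases Submodule.mem_span_finite_of_mem_span hmem with ⟨T, hT, hmemT⟩
    refine ⟨T, hT, ?_⟩
    rcases (Submodule.mem_span_finset).1 hmemT with ⟨c, -, hc⟩
    exact ⟨c, hc⟩
  -- lengths of the words behind the elements of `T`
  have hT' : ∀ f : (Fin 2 → Matrix (Fin k) (Fin k) ℂ) → Matrix (Fin k) (Fin k) ℂ, f ∈ T →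
      ∃ w : List (Fin 2), w.length ≤ d ∧ f = fun B => (w.map B).prod :=
    fun f hf => hT (Finset.mem_coe.2 hf)
  choose! wd hwd using hT'
  -- evaluate both sides at the scalar pair `t • 1`, entry `(0,0)`
  have key : ∀ t : ℂ, ∑ f ∈ T, c f * t ^ (wd f).length = t ^ (2 * d) := by
    intro t
    have h1 := congr_fun hc (fun _ => t • (1 : Matrix (Fin k) (Fin k) ℂ))
    have h2 := congr_fun (congr_fun h1 ⟨0, hk⟩) ⟨0, hk⟩
    simp only [Finset.sum_apply, Pi.smul_apply, Matrix.sum_apply, Matrix.smul_apply, smul_eq_mul,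
      smul_pow, one_pow, Matrix.one_apply_eq, mul_one] at h2
    rw [← h2]
    refine Finset.sum_congr rfl fun f hf => ?_
    have hf' := (hwd f hf).2
    have hval : f (fun _ => t • (1 : Matrix (Fin k) (Fin k) ℂ)) = t ^ (wd f).length • 1 := by
      have h := congr_fun hf' (fun _ => t • (1 : Matrix (Fin k) (Fin k) ℂ))
      simp only [List.map_const', List.prod_replicate, smul_pow, one_pow] at h
      exact h
    rw [hval, Matrix.smul_apply, Matrix.one_apply_eq, smul_eq_mul, mul_one]
  -- the polynomial `X^{2d} - Σ c_f X^{|w_f|}` vanishes identically, but its top coefficient is `1`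
  set P : Polynomial ℂ := Polynomial.X ^ (2 * d) -
    ∑ f ∈ T, Polynomial.C (c f) * Polynomial.X ^ (wd f).length with hP
  have hP0 : P = 0 := by
    apply Polynomial.funext
    intro t
    simp only [hP, Polynomial.eval_sub, Polynomial.eval_pow, Polynomial.eval_X,
      Polynomial.eval_finsetSum, Polynomial.eval_mul, Polynomial.eval_C, Polynomial.eval_zero]
    rw [key t, sub_self]
  have hcoeff : P.coeff (2 * d) = 1 := by
    simp only [hP, Polynomial.coeff_sub, Polynomial.coeff_X_pow, if_true,
      Polynomial.finsetSum_coeff, Polynomial.coeff_C_mul]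
    rw [Finset.sum_eq_zero, sub_zero]
    intro f hf
    have hlen := (hwd f hf).1
    have hne : 2 * d ≠ (wd f).length := by omega
    simp [hne]
  rw [hP0, Polynomial.coeff_zero] at hcoeff
  exact zero_ne_one hcoeff

/-- **The `ε = 0` slice of the crux is false at every masquerade, with no literature input**:
`LongMasquerade → ¬ (∀ k ≥ 2, ∃ n₁, ∀ n d A, n₁ ≤ n → GEN → MASQ → genericWordDim k (2d) ≤ n²)`.
(So `0 < ε` is used only through the factor `n^{2/k²}` of `masquerade_loose`; at `ε = 0` the crux is
unconditionally equivalent to the route's kill target `WindowedKaplansky`, cf. the disprover's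
`Disproof.lean`.) [folklore] -/
theorem not_tightWindowsZero_of_longMasquerade (hLM : LongMasquerade) :
    ¬ (∀ k : ℕ, 2 ≤ k → ∃ n₁ : ℕ, ∀ (n d : ℕ) (A : Fin 2 → Matrix (Fin n) (Fin n) ℂ), n₁ ≤ n →
      Submodule.span ℂ {M : Matrix (Fin n) (Fin n) ℂ |
        ∃ w : List (Fin 2), w.length ≤ d ∧ (w.map A).prod = M} = ⊤ →
      (∀ (T : Finset (List (Fin 2))) (c : List (Fin 2) → ℂ), (∀ w ∈ T, w.length ≤ 2 * d) →
        (∀ B : Fin 2 → Matrix (Fin k) (Fin k) ℂ, (∑ w ∈ T, c w • (w.map B).prod) = 0) →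
        (∑ w ∈ T, c w • (w.map A).prod) = 0) →
      genericWordDim k (2 * d) ≤ n ^ 2) := by
  intro h0
  obtain ⟨k, hk, hfam⟩ := hLM
  obtain ⟨n₁, hn₁⟩ := h0 k hk
  obtain ⟨n, d, A, hn, hspan, hwin⟩ := hfam (max n₁ 2)
  have hn1 : n₁ ≤ n := le_trans (le_max_left _ _) hn
  have hn2 : 2 ≤ n := le_trans (le_max_right _ _) hn
  have hd : 1 ≤ d := by
    by_contra hd0
    have hd0' : d = 0 := by omega
    subst hd0'
    have := sq_le_of_span hspan
    nlinarith
  have h1 := sq_le_genericWordDim hspan hwin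
  have h2 := genericWordDim_lt_double (k := k) (by omega) hd
  have h3 := hn₁ n d A hn1 hspan hwin
  omega

/-- **Negation theorem.**  Under the three named facts of PI-theory, the route's two cruxes are
contradictory: long masquerades (for a fixed `k`) are loose by a factor `n^{2/k²}`, so
`LongMasquerade → ¬ TightWindows`.  (Crux-strategist's theorem, ported; the crux `TightWindows`
itself is NOT refuted: it holds — vacuously — iff the windowed Kaplansky theorem holds for every `k`.)
[cite: KanelBelovKarasikRowen2015, Thm 1.4.17 + Thm 1.8.14 + Thm 11.3.6 + Thm 11.3.13 + §11.2.5 (consequence)] -/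
theorem not_tightWindows_of_longMasquerade (h₁ : razmyslov_exists_multilinear_centralPolynomial)
    (h₂ : amitsur_genericMatrices_isDomain) (h₃ : GenericMatricesQuasiPolynomialGrowth)
    (hLM : LongMasquerade) : ¬ TightWindows := by
  intro hT
  obtain ⟨k, hk, hfam⟩ := hLM
  obtain ⟨K₁, K₂, g, hK₁, hK₂, hg1, hloose⟩ := masquerade_loose h₁ h₂ h₃ hk
  have hq : 1 ≤ k ^ 2 := Nat.one_le_pow _ _ (by omega)
  obtain ⟨M, hM⟩ := bounded_of_loose hq K₁ (g : ℝ) hK₂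
  have hε : (0 : ℝ) < 1 / (k ^ 2 : ℕ) := by positivity
  obtain ⟨n₁, hn₁⟩ := hT k hk (1 / (k ^ 2 : ℕ)) hε
  obtain ⟨n, d, A, hn, hspan, hwin⟩ := hfam (max n₁ (max ((g + 1) * 2 ^ g + 1) (⌈M⌉₊ + 1)))
  have hn1 : n₁ ≤ n := le_trans (le_max_left _ _) hn
  have hn2 : (g + 1) * 2 ^ g < n := by
    have := le_trans (le_max_left _ _) (le_trans (le_max_right _ _) hn); omega
  have hn3 : M < n := by
    have h : ⌈M⌉₊ + 1 ≤ n := le_trans (le_max_right _ _) (le_trans (le_max_right _ _) hn)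
    have h' : (⌈M⌉₊ : ℝ) + 1 ≤ n := by exact_mod_cast h
    linarith [Nat.le_ceil M]
  obtain ⟨hb, hc, hd1⟩ := hloose n d A hn2 hspan hwin
  have hdim := hn₁ n d A hn1 hspan hwin
  -- `hdim` bounds exactly `genericWordDim k (2d)`
  change (genericWordDim k (2 * d) : ℝ) ≤ (n : ℝ) ^ ((2 : ℝ) + 1 / (k ^ 2 : ℕ)) at hdim
  refine hM n d hn3 (by exact_mod_cast hd1) hb ?_
  push_cast at hdim ⊢
  exact hc.trans hdim

/-- **Corollary.**  Under the three named facts the deciding theorem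
`closes (hL : LongMasquerade) (hT : TightWindows) …` of route MatrixPointInterpolation has jointly
unsatisfiable hypotheses: the route can never be fed.
[cite: KanelBelovKarasikRowen2015, Thm 1.4.17 + Thm 1.8.14 + Thm 11.3.6 + Thm 11.3.13 + §11.2.5 (consequence)] -/
theorem longMasquerade_and_tightWindows_false (h₁ : razmyslov_exists_multilinear_centralPolynomial)
    (h₂ : amitsur_genericMatrices_isDomain) (h₃ : GenericMatricesQuasiPolynomialGrowth) :
    ¬ (LongMasquerade ∧ TightWindows) := fun h =>
  not_tightWindows_of_longMasquerade h₁ h₂ h₃ h.1 h.2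

end TightWindowsLoose

end Summit.MatrixMultiplication.MatrixMultiplication.Theorems
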